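import Mathlib.FieldTheory.IsSepClosed
import Mathlib.FieldTheory.Galois.Basic
import Mathlib.FieldTheory.PrimitiveElement
import Mathlib.FieldTheory.Normal.Closure
import Mathlib.LinearAlgebra.FiniteDimensional.Lemmas
import Literature.AlgebraicGeometry.Frobenioids.FiniteEtaleBase
import HarnessLib

/-!
# Frobenioids II, §1 p. 7 / §3 p. 23: the base categories `D₀` are of FSM-type — PROOFS

Mochizuki, *The geometry of Frobenioids II: poly-Frobenioids*, Kyushu J. Math. **62** (2008)
401–460, §1 p. 7: "write `D₀` for the full subcategory of connected objects of the Galois category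
of finite étale coverings of `Spec(ℚ_p)`. Thus, `D₀` is a connected, totally epimorphic category,
which is of FSM-, hence also of FSMFF-type" [cite: MochizukiFrdII2008, §1 p.7]; the same sentence for
`Spec(ℝ)` in §3 p. 23 [cite: MochizukiFrdII2008, §3 p.23].

This is a PROOF-ONLY companion of `FiniteEtaleBase.lean` (statements by seat abc-iut-L1-t4, where
"of FSM-type" is recorded as the named facts `PadicBase.IsOfFSMTypeFact p` and
`ArchBase.IsOfFSMTypeFact`). We prove, for an arbitrary base field `F`, that in the category
`FinEtale F` (objects: finite separable field extensions `Spec K → Spec F`; arrows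
`Spec K → Spec L` = `F`-algebra maps `L → K`) **every monomorphism is an isomorphism**
(`FinEtale.isIso_of_mono`); in particular every FSM-morphism (fiberwise-surjective monomorphism,
[FrdI] §0 p. 14) is an isomorphism, i.e. `FinEtale F` is of FSM-type (`FinEtale.isOfFSMType`), and
the two named facts hold (`PadicBase.isOfFSMTypeFact_holds`, `ArchBase.isOfFSMTypeFact_holds`),
with the printed consequence "hence also of FSMFF-type".

Proof of `isIso_of_mono` (Galois theory / counting embeddings): let `f : Spec K → Spec L` be a
monomorphism, `ι = f.alg : L → K`. Let `N/F` be the normal closure of `K` inside a separable closure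
of `F`; `N` is a finite Galois extension of `F`, so `Spec N` is an object of `FinEtale F`, and all
minimal polynomials over `F` of elements of `K` and of `L` split in `N`. Since `f` is a monomorphism,
`φ ↦ φ ∘ ι` is injective on `Hom_F(K, N)`, whence `[K : F] = #Hom_F(K, N) ≤ #Hom_F(L, N) = [L : F]`
(Mathlib `AlgHom.card_of_splits`); as `ι` is an injective `F`-linear map, `[L : F] ≤ [K : F]`, so
`ι` is an `F`-linear injection between spaces of equal finite dimension, hence bijective.
No new definitions; nothing here bears on [IUTchIII].
-/

namespace Literature.AlgebraicGeometry.Frobenioids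

open CategoryTheory Module

universe u

namespace FinEtale

variable {F : Type u} [Field F]

/-- If `f : Spec K → Spec L` is a monomorphism of `FinEtale F`, then pre-composition with
`f.alg : L → K` is injective on `F`-algebra maps `K → M` for every object `Spec M`: two arrows
`Spec M ⇉ Spec K` equalised by `f` are equal. [cite: MochizukiFrdII2008, §1 p.7] -/
theorem comp_alg_injective_of_mono {X Y : FinEtale F} (f : X ⟶ Y) [Mono f] (Z : FinEtale F) :
    Function.Injective fun φ : (X →ₐ[F] Z) => φ.comp f.alg := by
  intro φ ψ h
  have hc : (⟨φ⟩ : Z ⟶ X) ≫ f = (⟨ψ⟩ : Z ⟶ X) ≫ f := hom_ext (by simpa using h)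
  exact congrArg Hom.alg ((cancel_mono f).mp hc)

/-- Counting step: if `f : Spec K → Spec L` is a monomorphism of `FinEtale F` and `K` admits an
`F`-embedding into an object `Spec N` with `N/F` normal, then the algebra map `L → K` underlying `f`
is surjective: `[K : F] = #Hom_F(K, N) ≤ #Hom_F(L, N) = [L : F] ≤ [K : F]` (Mathlib
`AlgHom.card_of_splits`), so `L → K` is an injective `F`-linear map between spaces of equal finite
dimension. [cite: MochizukiFrdII2008, §1 p.7] -/
theorem alg_surjective_of_mono_of_normal {X Y N : FinEtale F} (f : X ⟶ Y) [Mono f] [Normal F N]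
    (φ₀ : X →ₐ[F] N) : Function.Surjective f.alg := by
  classical
  -- all minimal polynomials of elements of `K` and of `L` split in `N`
  have hsX : ∀ x : X, ((minpoly F x).map (algebraMap F N)).Splits := fun x => by
    rw [← minpoly.algHom_eq φ₀ φ₀.injective x]
    exact Normal.splits inferInstance (φ₀ x)
  have hsY : ∀ y : Y, ((minpoly F y).map (algebraMap F N)).Splits := fun y => by
    rw [← minpoly.algHom_eq (φ₀.comp f.alg) (φ₀.comp f.alg).injective y]
    exact Normal.splits inferInstance _
  -- counting: `[K : F] ≤ [L : F]`
  have hcard : Fintype.card (X →ₐ[F] N) ≤ Fintype.card (Y →ₐ[F] N) :=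
    Fintype.card_le_of_injective _ (comp_alg_injective_of_mono f N)
  rw [AlgHom.card_of_splits F X N hsX, AlgHom.card_of_splits F Y N hsY] at hcard
  -- and `[L : F] ≤ [K : F]` since `f.alg` is injective
  have hle : finrank F Y ≤ finrank F X :=
    LinearMap.finrank_le_finrank_of_injective (f := f.alg.toLinearMap) f.alg.injective
  have heq : finrank F Y = finrank F X := le_antisymm hle hcard
  exact (LinearMap.injective_iff_surjective_of_finrank_eq_finrank (f := f.alg.toLinearMap) heq).mp
    f.alg.injective

/-- Every object `Spec K` of `FinEtale F` maps to an object `Spec N` with `N/F` normal (indeed finite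
Galois): embed `K` into a separable closure of `F` (Mathlib `IsSepClosed.lift`) and take the normal
closure of `K` there (Mathlib `IsGalois.normalClosure`, `normalClosure.is_finiteDimensional`).
[cite: MochizukiFrdII2008, §1 p.7] -/
theorem exists_hom_normal (X : FinEtale F) :
    ∃ N : FinEtale F, Normal F N ∧ Nonempty (X →ₐ[F] N) := by
  let ι : X →ₐ[F] SeparableClosure F := IsSepClosed.lift
  letI : Algebra X (SeparableClosure F) := ι.toRingHom.toAlgebra
  haveI : IsScalarTower F X (SeparableClosure F) :=
    IsScalarTower.of_algebraMap_eq fun x => (ι.commutes x).symm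
  haveI : IsGalois F (IntermediateField.normalClosure F X (SeparableClosure F)) :=
    IsGalois.normalClosure F X (SeparableClosure F)
  exact ⟨⟨IntermediateField.normalClosure F X (SeparableClosure F)⟩, IsGalois.to_normal,
    ⟨IsScalarTower.toAlgHom F X (IntermediateField.normalClosure F X (SeparableClosure F))⟩⟩

/-- The key step: the algebra map `L → K` underlying a monomorphism `Spec K → Spec L` of `FinEtale F`
is surjective. [cite: MochizukiFrdII2008, §1 p.7] -/
theorem alg_surjective_of_mono {X Y : FinEtale F} (f : X ⟶ Y) [Mono f] :
    Function.Surjective f.alg := by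
  obtain ⟨N, hN, ⟨φ₀⟩⟩ := exists_hom_normal X
  exact alg_surjective_of_mono_of_normal f φ₀

/-- **In `D₀ = FinEtale F` every monomorphism is an isomorphism** (the Galois-theoretic content of
"`D₀` … is of FSM-type", FrdII §1 p. 7 / §3 p. 23): a monomorphism `Spec K → Spec L` has bijective
underlying algebra map `L → K`, whose inverse is the required two-sided inverse.
[cite: MochizukiFrdII2008, §1 p.7] -/
theorem isIso_of_mono {X Y : FinEtale F} (f : X ⟶ Y) [Mono f] : IsIso f := by
  let e : Y ≃ₐ[F] X := AlgEquiv.ofBijective f.alg ⟨f.alg.injective, alg_surjective_of_mono f⟩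
  have he : (e : Y →ₐ[F] X) = f.alg := rfl
  refine ⟨⟨⟨(e.symm : X →ₐ[F] Y)⟩, ?_, ?_⟩⟩
  · apply hom_ext
    rw [comp_alg, id_alg, ← he]
    ext x
    simp
  · apply hom_ext
    rw [comp_alg, id_alg, ← he]
    ext y
    simp

/-- Monomorphisms of `D₀ = FinEtale F` are exactly the isomorphisms. [cite: MochizukiFrdII2008, §1 p.7] -/
theorem mono_iff_isIso {X Y : FinEtale F} (f : X ⟶ Y) : Mono f ↔ IsIso f :=
  ⟨fun _ => isIso_of_mono f, fun _ => inferInstance⟩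

variable (F) in
/-- **`D₀ = FinEtale F` is of FSM-type** for every base field `F`: every FSM-morphism
(fiberwise-surjective monomorphism, [FrdI] §0 p. 14) is an isomorphism — indeed every monomorphism
is (`isIso_of_mono`). This is the theorem behind the printed "`D₀` … is of FSM-type" (FrdII §1 p. 7
for `Spec ℚ_p`, §3 p. 23 for `Spec ℝ`). [cite: MochizukiFrdII2008, §1 p.7] -/
theorem isOfFSMType : IsOfFSMType (FinEtale F) :=
  ⟨fun f hf => by
    haveI := hf.2
    exact isIso_of_mono f⟩

variable (F) in
/-- "hence also of FSMFF-type" (FrdII §1 p. 7 / §3 p. 23), for every base field `F`.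
[cite: MochizukiFrdII2008, §1 p.7] -/
theorem isOfFSMFFType : IsOfFSMFFType (FinEtale F) :=
  isOfFSMFFType_of (isOfFSMType F)

end FinEtale

/-- **FrdII §1 p. 7, DISCHARGED**: "`D₀` [the connected finite étale coverings of `Spec(ℚ_p)`] …
is of FSM-type" — the named fact `PadicBase.IsOfFSMTypeFact p` of `FiniteEtaleBase.lean` holds.
[cite: MochizukiFrdII2008, §1 p.7] -/
theorem PadicBase.isOfFSMTypeFact_holds (p : ℕ) [Fact p.Prime] : PadicBase.IsOfFSMTypeFact p :=
  FinEtale.isOfFSMType ℚ_[p]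

/-- FrdII §1 p. 7: "hence also of FSMFF-type", for `D₀` over `ℚ_p`. [cite: MochizukiFrdII2008, §1 p.7] -/
theorem PadicBase.isOfFSMFFType (p : ℕ) [Fact p.Prime] : IsOfFSMFFType (PadicBase p) :=
  FinEtale.isOfFSMFFType ℚ_[p]

/-- **FrdII §3 p. 23, DISCHARGED**: "`D₀` [the connected finite étale coverings of `Spec(ℝ)`] … is
of FSM-type" — the named fact `ArchBase.IsOfFSMTypeFact` of `FiniteEtaleBase.lean` holds.
[cite: MochizukiFrdII2008, §3 p.23] -/
theorem ArchBase.isOfFSMTypeFact_holds : ArchBase.IsOfFSMTypeFact :=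
  FinEtale.isOfFSMType ℝ

/-- FrdII §3 p. 23: "hence also of FSMFF-type", for `D₀` over `ℝ`. [cite: MochizukiFrdII2008, §3 p.23] -/
theorem ArchBase.isOfFSMFFType : IsOfFSMFFType ArchBase :=
  FinEtale.isOfFSMFFType ℝ

end Literature.AlgebraicGeometry.Frobenioids
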